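import Summits.CriticalPhenomena.PercolationContinuityZ3.Theorems.Transplant.KNCells2ChainSched
import HarnessLib

/-!
# Corridor chain, planar schedule: the ROUTE SCALES ARE BOUNDED — `core_route` of KNCells2ChainSched (p217059) with the extra conclusion
# `ℓ ≤ 6t` (design (D): p3-g2's kit clause `BoxProdZ2ConcKits.hkits_tube` asks the planar room `hroom` for scales in a FINITE window
# `[ℓ₀, ℓ₁]`, since the link inputs at the running parameter form a finite family indexed by the scales; `ℓ₁ := 6t` serves every step)

builds on p205010 (kernel theorem, internal audit signed; external expert review pending) — nothing in this file uses p205010.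
Lane `prim-bschramm`, seat `prim-bschramm-p2` (instance assembly A1); helper file (`--supports stmt-CriticalPhenomena-4575`).  Pure `Site 2` geometry.

The four phase lemmas of the schedule are re-derived keeping the scale bound the planar route lemmas already provide
(`route_shrinkLong` / `route_shrinkTrans`: `ℓ ≤ Δ + R' + ℓ₀ = t + R' + ℓ₀ ≤ 2t`; `route_start`: `ℓ ≤ 2q + s + R' = 5t + 23R' ≤ 6t`;
`route_advance`: `ℓ ≤ s + R' = t + R' ≤ 2t`), under the standing `100 R' ≤ t`, `R' + ℓ₀ ≤ t`.
* **`core_route_le`** — for `i ≤ 86` and `v` in the `R'`-enlargement of `core i`: `∃ ℓ, ℓ₀ ≤ ℓ ∧ ℓ ≤ 6t ∧ v + Λ_ℓ ⊆ region i ∧` a quarter-face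
  `v + orthantFace a' τ ℓ ⊆ core (i+1)`.
[cite: KozmaNitzan2024, §4 Lemma 11 (pp. 22–23), Lemma 12 (pp. 23–25)]
-/

noncomputable section

namespace Summit.CriticalPhenomena.PercolationContinuityZ3.Theorems

namespace Transplant

namespace ChainPlanar

namespace Sched

open Literature.Probability.Percolation Literature.Probability.LatticeModels
open Literature.Probability.Percolation.KozmaNitzan
open Literature.Probability.Percolation.KozmaNitzan.Cells (oth oth_ne eq_oth_of_ne)

variable {t R' : ℕ}

section Route

variable {a : Fin 2} {σ : ℤ} (hσ : σ = 1 ∨ σ = -1) (c : Site 2) {ℓ₀ : ℕ} (hR : 100 * R' ≤ t) (hℓ : R' + ℓ₀ ≤ t)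
include hσ hR hℓ

/-- Routes of the shrink-along rounds `i < 10`, scale `≤ 6t`. [cite: KozmaNitzan2024, §4 Lemma 12 (pp. 23–25)] -/
theorem core_route_AL_le {i : ℕ} (hi : i < 10) {v : Site 2}
    (hv : v ∈ sBox a σ c (coreα t R' i - R') (coreβ t R' i + R') (coreW t R' i + R')) :
    ∃ ℓ : ℕ, ℓ₀ ≤ ℓ ∧ ℓ ≤ 6 * t ∧ shiftF v (box 2 ℓ) ⊆ region t R' a σ c i ∧
      ∃ (a' : Fin 2) (τ : Fin 2 → ℤˣ), shiftF v (orthantFace a' τ ℓ) ⊆ core t R' a σ c (i + 1) := by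
  have hR' : 100 * (R' : ℤ) ≤ t := by exact_mod_cast hR
  have hℓ' : (R' : ℤ) + ℓ₀ ≤ t := by exact_mod_cast hℓ
  obtain ⟨eα, eβ, eW⟩ := core_AL (t := t) (R' := R') hi.le
  obtain ⟨eα', eβ', eW'⟩ := core_AL (t := t) (R' := R') (i := i + 1) hi
  have his : ((i : ℤ) + 1) * t ≤ 10 * t := mul_le_mul_of_nonneg_right (by exact_mod_cast (show i + 1 ≤ 10 from hi)) (by positivity)
  have hiR : (i : ℤ) * R' ≤ 10 * R' := mul_le_mul_of_nonneg_right (by exact_mod_cast hi.le) (by positivity)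
  have hi0 : (0 : ℤ) ≤ (i : ℤ) * t := by positivity
  have hiR0 : (0 : ℤ) ≤ (i : ℤ) * R' := by positivity
  have ht0 : (0 : ℤ) ≤ t := by positivity
  rw [eα, eβ, eW] at hv
  obtain ⟨ℓ, hℓ0, hℓhi, hsq, τ, hface⟩ := route_shrinkLong hσ c (u := 12 * (t : ℤ) - (i : ℤ) * t)
    (u' := 12 * (t : ℤ) - ((i : ℤ) + 1) * t) (w := 12 * (t : ℤ) + (i : ℤ) * R') (Δ := t) (ρ := 20 * t) (R' := R') (ℓ₀ := ℓ₀)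
    (by ring) (by linarith) ht0 (by linarith) (by linarith) (by linarith) hv
  refine ⟨ℓ, hℓ0, ?_, by rw [region_A (by omega)]; exact hsq, a, τ, ?_⟩
  · have : (ℓ : ℤ) ≤ 6 * t := by linarith
    exact_mod_cast this
  · rw [core, eα', eβ', eW']
    convert hface using 2 <;> push_cast <;> ring

/-- Routes of the shrink-across rounds `10 ≤ i < 21`, scale `≤ 6t`. [cite: KozmaNitzan2024, §4 Lemma 12 (pp. 23–25)] -/
theorem core_route_AT_le {i : ℕ} (h1 : 10 ≤ i) (h2 : i < 21) {v : Site 2}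
    (hv : v ∈ sBox a σ c (coreα t R' i - R') (coreβ t R' i + R') (coreW t R' i + R')) :
    ∃ ℓ : ℕ, ℓ₀ ≤ ℓ ∧ ℓ ≤ 6 * t ∧ shiftF v (box 2 ℓ) ⊆ region t R' a σ c i ∧
      ∃ (a' : Fin 2) (τ : Fin 2 → ℤˣ), shiftF v (orthantFace a' τ ℓ) ⊆ core t R' a σ c (i + 1) := by
  have hR' : 100 * (R' : ℤ) ≤ t := by exact_mod_cast hR
  have hℓ' : (R' : ℤ) + ℓ₀ ≤ t := by exact_mod_cast hℓ
  set m : ℕ := i - 10 with hm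
  have hm1 : m + 1 ≤ 11 := by omega
  obtain ⟨eα, eβ, eW⟩ := core_AT (t := t) (R' := R') (i := i) (m := m) (by omega) (by omega)
  obtain ⟨eα', eβ', eW'⟩ := core_AT (t := t) (R' := R') (i := i + 1) (m := m + 1) (by omega) hm1
  have hms : ((m : ℤ) + 1) * t ≤ 11 * t := mul_le_mul_of_nonneg_right (by exact_mod_cast hm1) (by positivity)
  have hmR : (m : ℤ) * R' ≤ 11 * R' := mul_le_mul_of_nonneg_right (by exact_mod_cast (show m ≤ 11 by omega)) (by positivity)
  have hm0 : (0 : ℤ) ≤ (m : ℤ) * t := by positivity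
  have hmR0 : (0 : ℤ) ≤ (m : ℤ) * R' := by positivity
  have ht0 : (0 : ℤ) ≤ t := by positivity
  rw [eα, eβ, eW] at hv
  obtain ⟨ℓ, hℓ0, hℓhi, hsq, τ, hface⟩ := route_shrinkTrans hσ c (u := 2 * (t : ℤ) + (m : ℤ) * R')
    (w := 12 * (t : ℤ) + 10 * R' - (m : ℤ) * t) (w' := 12 * (t : ℤ) + 10 * R' - ((m : ℤ) + 1) * t)
    (Δ := t) (ρ := 20 * t) (R' := R') (ℓ₀ := ℓ₀)
    (by ring) (by linarith) ht0 (by linarith) (by linarith) (by linarith) hv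
  refine ⟨ℓ, hℓ0, ?_, by rw [region_A (by omega)]; exact hsq, oth a, τ, ?_⟩
  · have : (ℓ : ℤ) ≤ 6 * t := by linarith
    exact_mod_cast this
  · rw [core, eα', eβ', eW']
    convert hface using 2 <;> push_cast <;> ring

/-- Route of the start step `i = 21`, scale `≤ 6t`. [cite: KozmaNitzan2024, §4 Lemmas 11–12] -/
theorem core_route_start_le {v : Site 2}
    (hv : v ∈ sBox a σ c (coreα t R' 21 - R') (coreβ t R' 21 + R') (coreW t R' 21 + R')) :
    ∃ ℓ : ℕ, ℓ₀ ≤ ℓ ∧ ℓ ≤ 6 * t ∧ shiftF v (box 2 ℓ) ⊆ region t R' a σ c 21 ∧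
      ∃ (a' : Fin 2) (τ : Fin 2 → ℤˣ), shiftF v (orthantFace a' τ ℓ) ⊆ core t R' a σ c 22 := by
  have hR' : 100 * (R' : ℤ) ≤ t := by exact_mod_cast hR
  have hℓ' : (R' : ℤ) + ℓ₀ ≤ t := by exact_mod_cast hℓ
  obtain ⟨eα, eβ, eW⟩ := core_AT (t := t) (R' := R') (i := 21) (m := 11) rfl le_rfl
  obtain ⟨eα', eβ', eW'⟩ := core_B (t := t) (R' := R') (i := 22) (j := 1) rfl le_rfl
  rw [eα, eβ, eW] at hv
  have hR0 : (0 : ℤ) ≤ R' := by positivity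
  obtain ⟨ℓ, hℓ0, hℓhi, -, hsq, τ, -, hface⟩ := route_start hσ c (q := 2 * (t : ℤ) + 11 * R')
    (q' := 12 * (t : ℤ) + 10 * R' - 11 * t) (s := t) (w₁ := w₁ t R') (ρ := 20 * t) (R' := R') (ℓ₀ := ℓ₀)
    hℓ' (by unfold w₁; linarith) (by linarith) (by linarith) (by convert hv using 2 <;> push_cast <;> ring)
  refine ⟨ℓ, hℓ0, ?_, ?_, a, τ, ?_⟩
  · have : (ℓ : ℤ) ≤ 6 * t := by linarith
    exact_mod_cast this
  · rw [region_A le_rfl]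
    exact hsq.trans (sBox_mono hσ c le_rfl (by linarith) le_rfl)
  · rw [core, eα', eβ', eW']
    convert hface using 2 <;> push_cast <;> ring

/-- Routes of the advance steps `i = 21 + j`, `1 ≤ j ≤ 65`, scale `≤ 6t`. [cite: KozmaNitzan2024, §4 Lemma 11 (pp. 22–23)] -/
theorem core_route_B_le {i j : ℕ} (hij : i = 21 + j) (hj : 1 ≤ j) (hjB : j ≤ 65) {v : Site 2}
    (hv : v ∈ sBox a σ c (coreα t R' i - R') (coreβ t R' i + R') (coreW t R' i + R')) :
    ∃ ℓ : ℕ, ℓ₀ ≤ ℓ ∧ ℓ ≤ 6 * t ∧ shiftF v (box 2 ℓ) ⊆ region t R' a σ c i ∧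
      ∃ (a' : Fin 2) (τ : Fin 2 → ℤˣ), shiftF v (orthantFace a' τ ℓ) ⊆ core t R' a σ c (i + 1) := by
  have hR' : 100 * (R' : ℤ) ≤ t := by exact_mod_cast hR
  have hℓ' : (R' : ℤ) + ℓ₀ ≤ t := by exact_mod_cast hℓ
  obtain ⟨eα, eβ, eW⟩ := core_B (t := t) (R' := R') hij hj
  obtain ⟨eα', eβ', eW'⟩ := core_B (t := t) (R' := R') (i := i + 1) (j := j + 1) (by omega) (by omega)
  have hjR : ((j : ℤ) - 1) * R' ≤ 64 * R' := mul_le_mul_of_nonneg_right (by linarith [(by exact_mod_cast hjB : (j : ℤ) ≤ 65)]) (by positivity)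
  have hjR0 : 0 ≤ ((j : ℤ) - 1) * R' := mul_nonneg (by linarith [(by exact_mod_cast hj : (1 : ℤ) ≤ j)]) (by positivity)
  have hR0 : (0 : ℤ) ≤ R' := by positivity
  rw [eα, eβ, eW] at hv
  obtain ⟨ℓ, hℓ0, hℓhi, -, hsq, τ, -, hface⟩ := route_advance hσ c (L := 2 * (t : ℤ) + 11 * R' + (j : ℤ) * t) (s := t)
    (w := w₁ t R' + ((j : ℤ) - 1) * R') (ρ := 8 * t) (R' := R') (ℓ₀ := ℓ₀) hℓ' (by linarith) (by unfold w₁; linarith)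
    (by unfold w₁; linarith) hv
  refine ⟨ℓ, hℓ0, ?_, by rw [region_B hij hj]; exact hsq, a, τ, ?_⟩
  · have : (ℓ : ℤ) ≤ 6 * t := by linarith
    exact_mod_cast this
  · rw [core, eα', eβ', eW']
    convert hface using 2 <;> push_cast <;> ring

/-- **ROUTES WITH BOUNDED SCALES.**  For every step `i ≤ 86` and every `v` in the `R'`-enlargement of `core i` there is a scale
`ℓ ∈ [ℓ₀, 6t]` with the square `v + Λ_ℓ ⊆ region i` and a quarter-face `v + orthantFace a' τ ℓ ⊆ core (i+1)`.
[cite: KozmaNitzan2024, §4 Lemmas 11–12] -/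
theorem core_route_le {i : ℕ} (hi : i ≤ nLast) {v : Site 2}
    (hv : v ∈ sBox a σ c (coreα t R' i - R') (coreβ t R' i + R') (coreW t R' i + R')) :
    ∃ ℓ : ℕ, ℓ₀ ≤ ℓ ∧ ℓ ≤ 6 * t ∧ shiftF v (box 2 ℓ) ⊆ region t R' a σ c i ∧
      ∃ (a' : Fin 2) (τ : Fin 2 → ℤˣ), shiftF v (orthantFace a' τ ℓ) ⊆ core t R' a σ c (i + 1) := by
  unfold nLast at hi
  by_cases h1 : i < 10
  · exact core_route_AL_le hσ c hR hℓ h1 hv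
  by_cases h2 : i < 21
  · exact core_route_AT_le hσ c hR hℓ (by omega) h2 hv
  by_cases h3 : i = 21
  · subst h3; exact core_route_start_le hσ c hR hℓ hv
  · exact core_route_B_le hσ c hR hℓ (j := i - 21) (by omega) (by omega) (by omega) hv

end Route

end Sched

end ChainPlanar

end Transplant

end Summit.CriticalPhenomena.PercolationContinuityZ3.Theorems

end
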